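import Literature.MathematicalPhysics.QuantumLattice.HubbardScaleReportCT

/-!
# The gap clauses of the CT report are satisfiable by model-independent normal-form data

Negative knowledge on crux `SeededBrokenRegimeBoseFermiPinned` (stmt-HubbardSuperconductivity-14047) and on every
statement typed over `hubbardScaleReportCT` (refuter `refuter-drefute-stmt-HubbardSuperconductivity-14047-0`,
drefute of line `seed-strength-flow`, 2026-08-16; it supports witness W1 of the `stub-misstated` finding on
`stub_seedLowering`, `Cruxes/SeededBrokenRegimeBoseFermiPinned/DrefuteStubSeedLowering.md`).

In `IsRealisedAtCT L M β U μ h K Λ₀ Np nodal p` the normal-form data `q : HubbardNormalForm L Np` are `∃`-bound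
and tied to the effective action ONLY through the remainder clause `scaledRemainderNormCT … q ≤ p.remainderNorm`;
the gap function read by `GapConditionCT` / `SignConditionCT` is `gapFunction L h q k = h φ_d(k) + q.anom k` with
`q.anom` FREE.  Hence (`exists_isRealisedAtCT_gap_ge`): for EVERY `(U, μ, K, h, Λ₀, L ≥ 1, M, β > 0, Np)` and every
`A ≥ 4√2|h|` there is a REALISED tuple with empty nodal set whose reported gap is `≥ A − 4√2|h|` on every nonempty
CT patch-shell (and `0` on empty ones), realised by the constant-anomalous-term normal form `a ≡ A`, `n = z = 0`,
whose remainder norm is simply reported — whatever that number is.  Consequence: the off-nodal gap threshold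
`c·Λ₀ ≤ (D.gap i).fst` of `HubbardScaleData.MeetsThresholdsWith` certifies nothing about the model unless the
remainder threshold `etaStar` is small enough to exclude such dishonest normal forms; a one-seed hypothesis
quantified `∀ etaStar` (as in `stub_seedLowering` of line `seed-strength-flow`) is cheap at large `etaStar`.
Unconditional; nothing about any model quantity is claimed.
-/

noncomputable section

set_option linter.dupNamespace false

namespace Summit.HubbardSuperconductivity.HubbardSuperconductivity.Theorems.SeededBrokenRegimeBoseFermiPinned.Negative

open Literature.MathematicalPhysics.QuantumLattice Literature.Probability.LatticeModels

/-- `|φ_d| ≤ 4√2` for the `d_{x²−y²}` symbol `φ_d = 2√2 (cos p₁ − cos p₂)`. [folklore] -/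
theorem abs_dWaveSymbol_le (L : ℕ) (k : TorusSite 2 L) : |dWaveSymbol L k| ≤ 4 * Real.sqrt 2 := by
  rw [dWaveSymbol, abs_mul, abs_mul, abs_of_pos two_pos, abs_of_nonneg (Real.sqrt_nonneg 2)]
  have h1 := Real.abs_cos_le_one (latticeMomentum L k 0)
  have h2 := Real.abs_cos_le_one (latticeMomentum L k 1)
  have h3 : |Real.cos (latticeMomentum L k 0) - Real.cos (latticeMomentum L k 1)| ≤ 2 :=
    (abs_sub _ _).trans (by linarith)
  calc 2 * Real.sqrt 2 * |Real.cos (latticeMomentum L k 0) - Real.cos (latticeMomentum L k 1)|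
      ≤ 2 * Real.sqrt 2 * 2 := by gcongr
    _ = 4 * Real.sqrt 2 := by ring

/-- **The gap and sign clauses of the CT report are satisfiable by model-independent data.**  For every effective
action (any `U, μ`, frame `K`, seed `h`, scale `Λ₀`, `L ≥ 1`, `M`, `β > 0`, patch number `Np`) and every
`A ≥ 4√2|h|` there is a parameter tuple REALISED in the sense of `IsRealisedAtCT` with EMPTY nodal set whose
reported gap is at least `A − 4√2|h|` on every nonempty CT patch-shell: it is realised by the normal form with
constant anomalous self-energy `a ≡ A` (normal shift and field renormalisation `0`), whose scaled remainder norm is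
reported as it is.  So the off-nodal gap threshold of `MeetsThresholdsWith` binds the model only jointly with a
remainder threshold small enough to force an honest normal form. [folklore] -/
theorem exists_isRealisedAtCT_gap_ge (L M : ℕ) [NeZero L] {β : ℝ} (hβ : 0 < β) (U μ h : ℝ) (K : TrigPolyC4v)
    (Λ₀ : ℝ) (Np : ℕ) {A : ℝ} (hA : 4 * Real.sqrt 2 * |h| ≤ A) :
    ∃ p : HubbardScaleData.Parameters Np, IsRealisedAtCT L M β U μ h K Λ₀ Np ∅ p ∧
      (∀ i, (patchShellCT L μ K Λ₀ Np i).Nonempty → A - 4 * Real.sqrt 2 * |h| ≤ p.gap i) ∧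
      ∃ q : HubbardNormalForm L Np, q.shift = 0 ∧ q.anom = (fun _ => A) ∧ q.zren = 0 ∧
        p.remainderNorm = scaledRemainderNormCT L M β U μ h K Λ₀ q := by
  -- the constant-anomalous-term normal form
  set q : HubbardNormalForm L Np := ⟨0, fun _ => A, 0, 0, 0, 0, 0, 0, 0, 0⟩ with hq
  have heven : q.IsEven := fun _ => ⟨rfl, rfl, rfl⟩
  have hgf : ∀ k, gapFunction L h q k = h * dWaveSymbol L k + A := fun _ => rfl
  have hge : ∀ k, A - 4 * Real.sqrt 2 * |h| ≤ gapFunction L h q k := by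
    intro k
    rw [hgf]
    have h1 : |h * dWaveSymbol L k| ≤ |h| * (4 * Real.sqrt 2) := by
      rw [abs_mul]
      exact mul_le_mul_of_nonneg_left (abs_dWaveSymbol_le L k) (abs_nonneg h)
    have h2 := neg_abs_le (h * dWaveSymbol L k)
    linarith
  -- a min-modulus gap report on every patch
  have hrep : ∀ i : Fin Np, ∃ g : ℝ, GapConditionCT L μ K h Λ₀ q i g ∧
      ((patchShellCT L μ K Λ₀ Np i).Nonempty → A - 4 * Real.sqrt 2 * |h| ≤ g) := by
    intro i
    by_cases hS : (patchShellCT L μ K Λ₀ Np i).Nonempty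
    · obtain ⟨k₀, hk₀, hmin⟩ := (patchShellCT L μ K Λ₀ Np i).exists_min_image
        (fun k => |gapFunction L h q k|) hS
      refine ⟨gapFunction L h q k₀, ⟨fun he => ?_, fun _ => ⟨k₀, hk₀, rfl⟩, fun k hk => hmin k hk⟩,
        fun _ => hge k₀⟩
      rw [he] at hk₀
      simp at hk₀
    · refine ⟨0, ⟨fun _ => rfl, fun hne => absurd (Finset.nonempty_iff_ne_empty.2 hne) hS, fun k hk => ?_⟩,
        fun hS' => absurd hS' hS⟩
      exact absurd ⟨k, hk⟩ hS
  choose g hg using hrep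
  refine ⟨⟨g, scaleStiffnessCT L M β U μ h K Λ₀, scaleCompressibilityCT L M β U μ h K Λ₀, 0, 0,
    scaledRemainderNormCT L M β U μ h K Λ₀ q, scaleMeanFieldDensityCT L M β U μ h K Λ₀⟩, ?_,
    fun i hS => (hg i).2 hS, q, rfl, rfl, rfl, rfl⟩
  refine ⟨hβ, q, heven, fun i => (hg i).1, fun i _ => ?_, fun i hi => by simp at hi, rfl, rfl, rfl, le_rfl⟩
  -- constant sign: every value of the gap function is `≥ A − 4√2|h| ≥ 0`
  intro k _ k' _
  have hk := hge k
  have hk' := hge k'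
  exact mul_nonneg (by linarith) (by linarith)

end Summit.HubbardSuperconductivity.HubbardSuperconductivity.Theorems.SeededBrokenRegimeBoseFermiPinned.Negative
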